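import Mathlib
import Summits.FinalStateConjecture.FinalStateConjecture.Theorems.LaminatedThresholdCombMonotoneZero

/-!
# Comb lemma, localisation step 1: seed graphs from transverse `C¹` seeds

A `C¹` function `G` near `(0, σ) ∈ E × ℝ` with `G (0, σ) = 0` and `∂ₜ G (0, σ) ≠ 0` has, over
small balls `‖x‖ ≤ α`, a zero set containing the graph of a Lipschitz function `g` with
`g x → σ` (`x → 0`); the Lipschitz constant does not depend on the required closeness `ε₁`.
Proof by the monotone intermediate value theorem (`exists_continuousOn_zero`) and the mean value
inequality — no implicit function theorem is needed.
-/

set_option linter.dupNamespace false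

namespace Summit.FinalStateConjecture.FinalStateConjecture.Theorems.LaminatedThreshold.Comb

open Set Function Filter Topology Metric

variable {E : Type*} [NormedAddCommGroup E] [NormedSpace ℝ E]

omit [NormedSpace ℝ E] in
/-- Norm of the vertical unit vector of `E × ℝ` (sup norm). [folklore] -/
theorem norm_vertical : ‖((0 : E), (1 : ℝ))‖ = 1 := by
  simp [Prod.norm_def]

/-- **Seed graph.** [folklore] -/
theorem exists_seed_graph : ∀ {E : Type*} [NormedAddCommGroup E] [NormedSpace ℝ E] {G : E × ℝ → ℝ} {σ r' : ℝ}, 0 < r' → ContDiffOn ℝ 1 G (Metric.ball ((0 : E), σ) r') → G ((0 : E), σ) = 0 → fderiv ℝ G ((0 : E), σ) ((0 : E), (1 : ℝ)) ≠ 0 → ∃ kg : ℝ, 0 ≤ kg ∧ ∀ ε₁ : ℝ, 0 < ε₁ → ∃ α : ℝ, 0 < α ∧ ∃ g : E → ℝ, (∀ x : E, ‖x‖ ≤ α → G (x, g x) = 0 ∧ |g x - σ| < ε₁) ∧ (∀ x x' : E, ‖x‖ ≤ α → ‖x'‖ ≤ α → |g x - g x'| ≤ kg * ‖x - x'‖)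 := by
  intro E _ _ G σ r' hr' hG hG0 hGt
  -- normalise the transverse derivative to `1`
  set c : ℝ := fderiv ℝ G ((0 : E), σ) ((0 : E), (1 : ℝ)) with hc
  set G' : E × ℝ → ℝ := fun p ↦ c⁻¹ * G p with hG'
  set p₀ : E × ℝ := ((0 : E), σ) with hp₀
  have hG'cd : ContDiffOn ℝ 1 G' (ball p₀ r') := contDiffOn_const.mul hG
  have hdiff : ∀ p ∈ ball p₀ r', DifferentiableAt ℝ G' p := fun p hp ↦
    (hG'cd.differentiableOn one_ne_zero p hp).differentiableAt (isOpen_ball.mem_nhds hp)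
  have hdiffG : ∀ p ∈ ball p₀ r', DifferentiableAt ℝ G p := fun p hp ↦
    (hG.differentiableOn one_ne_zero p hp).differentiableAt (isOpen_ball.mem_nhds hp)
  set D : E × ℝ → (E × ℝ →L[ℝ] ℝ) := fun p ↦ fderiv ℝ G' p with hD
  have hDcont : ContinuousOn D (ball p₀ r') := hG'cd.continuousOn_fderiv_of_isOpen isOpen_ball le_rfl
  have hp₀mem : p₀ ∈ ball p₀ r' := mem_ball_self hr'
  have hD₀ : D p₀ ((0 : E), (1 : ℝ)) = 1 := by
    have : fderiv ℝ G' p₀ = c⁻¹ • fderiv ℝ G p₀ := by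
      simp only [hG']
      exact fderiv_const_mul (hdiffG p₀ hp₀mem) c⁻¹
    simp only [hD]
    rw [this]
    show c⁻¹ • ((fderiv ℝ G p₀) ((0 : E), (1 : ℝ))) = 1
    rw [smul_eq_mul, ← hc, inv_mul_cancel₀ hGt]
  -- a closed ball on which `∂ₜ G' ≥ 1/2` and `‖D‖ ≤ M`
  obtain ⟨α₀, hα₀, hα₀r, hDnear⟩ : ∃ α₀ : ℝ, 0 < α₀ ∧ α₀ < r' ∧
      ∀ p, dist p p₀ ≤ α₀ → ‖D p - D p₀‖ ≤ 1 / 2 := by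
    have hca : ContinuousAt D p₀ := (hDcont p₀ hp₀mem).continuousAt (isOpen_ball.mem_nhds hp₀mem)
    obtain ⟨δ₀, hδ₀, hδ⟩ := Metric.continuousAt_iff.1 hca (1 / 2) (by norm_num)
    refine ⟨min (δ₀ / 2) (r' / 2), by positivity, by
      linarith [min_le_right (δ₀ / 2) (r' / 2)], fun p hp ↦ ?_⟩
    have : dist p p₀ < δ₀ := by linarith [min_le_left (δ₀ / 2) (r' / 2)]
    rw [← dist_eq_norm]; exact (hδ this).le
  set M : ℝ := ‖D p₀‖ + 1 / 2 with hM
  have hM0 : 0 ≤ M := by positivity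
  have hball : ∀ p, dist p p₀ ≤ α₀ → p ∈ ball p₀ r' := fun p hp ↦
    mem_ball.2 (lt_of_le_of_lt hp hα₀r)
  have hDbound : ∀ p, dist p p₀ ≤ α₀ → ‖D p‖ ≤ M := fun p hp ↦ by
    have := norm_le_insert' (D p) (D p₀); linarith [hDnear p hp]
  have hDvert : ∀ p, dist p p₀ ≤ α₀ → 1 / 2 ≤ D p ((0 : E), (1 : ℝ)) := by
    intro p hp
    have h1 : |(D p - D p₀) ((0 : E), (1 : ℝ))| ≤ 1 / 2 := by
      have := (D p - D p₀).le_opNorm ((0 : E), (1 : ℝ))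
      rw [norm_vertical, mul_one, Real.norm_eq_abs] at this
      exact this.trans (hDnear p hp)
    have h2 : (D p - D p₀) ((0 : E), (1 : ℝ)) = D p ((0 : E), (1 : ℝ)) - D p₀ ((0 : E), (1 : ℝ)) :=
      rfl
    rw [h2, hD₀] at h1
    linarith [(abs_le.1 h1).1]
  -- membership of box points in the closed ball
  have hbox : ∀ (x : E) (t : ℝ), ‖x‖ ≤ α₀ → t ∈ Icc (σ - α₀) (σ + α₀) → dist (x, t) p₀ ≤ α₀ := by
    intro x t hx ht
    rw [Prod.dist_eq, hp₀]
    refine max_le (by simpa using hx) ?_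
    rw [Real.dist_eq]; exact abs_le.2 ⟨by linarith [ht.1], by linarith [ht.2]⟩
  -- vertical derivative and vertical lower bound
  have hderiv : ∀ (x : E) (t : ℝ), (x, t) ∈ ball p₀ r' →
      HasDerivAt (fun s : ℝ ↦ G' (x, s)) (D (x, t) ((0 : E), (1 : ℝ))) t := by
    intro x t hxt
    have h1 : HasFDerivAt G' (D (x, t)) (x, t) := (hdiff _ hxt).hasFDerivAt
    have h2 : HasDerivAt (fun s : ℝ ↦ ((x, s) : E × ℝ)) ((0 : E), (1 : ℝ)) t :=
      (hasDerivAt_const t x).prodMk (hasDerivAt_id t)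
    exact h1.comp_hasDerivAt t h2
  have hvert : ∀ x : E, ‖x‖ ≤ α₀ → ∀ t₁ ∈ Icc (σ - α₀) (σ + α₀), ∀ t₂ ∈ Icc (σ - α₀) (σ + α₀),
      t₁ ≤ t₂ → 1 / 2 * (t₂ - t₁) ≤ G' (x, t₂) - G' (x, t₁) := by
    intro x hx t₁ ht₁ t₂ ht₂ h12
    have hd : ∀ t ∈ Icc (σ - α₀) (σ + α₀),
        HasDerivAt (fun s : ℝ ↦ G' (x, s)) (D (x, t) ((0 : E), (1 : ℝ))) t :=
      fun t ht ↦ hderiv x t (hball _ (hbox x t hx ht))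
    refine (convex_Icc (σ - α₀) (σ + α₀)).mul_sub_le_image_sub_of_le_deriv
      (fun t ht ↦ (hd t ht).continuousAt.continuousWithinAt)
      (fun t ht ↦ (hd t (interior_subset ht)).differentiableAt.differentiableWithinAt)
      (fun t ht ↦ ?_) t₁ ht₁ t₂ ht₂ h12
    rw [(hd t (interior_subset ht)).deriv]
    exact hDvert _ (hbox x t hx (interior_subset ht))
  -- horizontal Lipschitz bound
  have hhoriz : ∀ (x x' : E) (t : ℝ), ‖x‖ ≤ α₀ → ‖x'‖ ≤ α₀ → t ∈ Icc (σ - α₀) (σ + α₀) →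
      |G' (x', t) - G' (x, t)| ≤ M * ‖x' - x‖ := by
    intro x x' t hx hx' ht
    have hconv : Convex ℝ (closedBall p₀ α₀) := convex_closedBall p₀ α₀
    have h := hconv.norm_image_sub_le_of_norm_fderiv_le (f := G') (𝕜 := ℝ)
      (fun p hp ↦ hdiff p (hball p (mem_closedBall.1 hp)))
      (fun p hp ↦ hDbound p (mem_closedBall.1 hp))
      (mem_closedBall.2 (hbox x t hx ht)) (mem_closedBall.2 (hbox x' t hx' ht))
    rw [Real.norm_eq_abs] at h
    refine h.trans (le_of_eq ?_)
    congr 1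
    simp [Prod.norm_def]
  -- signs at the ends of the vertical segments, for `‖x‖ ≤ α₁`
  set α₁ : ℝ := min α₀ (α₀ / (4 * (M + 1))) with hα₁
  have hα₁ : 0 < α₁ := by positivity
  have hα₁₀ : α₁ ≤ α₀ := min_le_left _ _
  have hG'0 : G' p₀ = 0 := by simp only [hG']; rw [hG0, mul_zero]
  have hσmem : σ ∈ Icc (σ - α₀) (σ + α₀) := ⟨by linarith, by linarith⟩
  have htop : σ + α₀ ∈ Icc (σ - α₀) (σ + α₀) := ⟨by linarith, le_rfl⟩
  have hbot : σ - α₀ ∈ Icc (σ - α₀) (σ + α₀) := ⟨le_rfl, by linarith⟩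
  have hMα : M * α₁ ≤ α₀ / 4 := by
    have : α₁ ≤ α₀ / (4 * (M + 1)) := min_le_right _ _
    calc M * α₁ ≤ M * (α₀ / (4 * (M + 1))) := by gcongr
      _ = α₀ / 4 * (M / (M + 1)) := by field_simp
      _ ≤ α₀ / 4 * 1 := by gcongr; exact (div_le_one (by positivity)).2 (by linarith)
      _ = α₀ / 4 := mul_one _
  have hpos_top : ∀ x : E, ‖x‖ ≤ α₁ → 0 < G' (x, σ + α₀) := by
    intro x hx
    have h1 := hvert 0 (by simpa using hα₀.le) σ hσmem (σ + α₀) htop (by linarith)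
    have h2 := hhoriz 0 x (σ + α₀) (by simpa using hα₀.le) (hx.trans hα₁₀) htop
    rw [sub_zero] at h2
    have h3 : G' ((0 : E), σ) = 0 := hG'0
    have h4 : M * ‖x‖ ≤ M * α₁ := by gcongr
    linarith [(abs_le.1 h2).1]
  have hneg_bot : ∀ x : E, ‖x‖ ≤ α₁ → G' (x, σ - α₀) < 0 := by
    intro x hx
    have h1 := hvert 0 (by simpa using hα₀.le) (σ - α₀) hbot σ hσmem (by linarith)
    have h2 := hhoriz 0 x (σ - α₀) (by simpa using hα₀.le) (hx.trans hα₁₀) hbot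
    rw [sub_zero] at h2
    have h3 : G' ((0 : E), σ) = 0 := hG'0
    have h4 : M * ‖x‖ ≤ M * α₁ := by gcongr
    linarith [(abs_le.1 h2).2]
  -- the graph over the closed ball of radius `α₁`
  have hcontG' : ContinuousOn (fun p : E × ℝ ↦ G' (p.1, p.2))
      (closedBall (0 : E) α₁ ×ˢ Icc (σ - α₀) (σ + α₀)) := by
    simp only [Prod.mk.eta]
    refine hG'cd.continuousOn.mono fun p hp ↦ hball p ?_
    have := hbox p.1 p.2 ((mem_closedBall_zero_iff.1 hp.1).trans hα₁₀) hp.2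
    simpa using this
  obtain ⟨g, -, hg, hguniq⟩ := exists_continuousOn_zero (fun (x : E) (t : ℝ) ↦ G' (x, t))
    (closedBall (0 : E) α₁) (by linarith : σ - α₀ ≤ σ + α₀) hcontG'
    (fun x hx ↦ fun t₁ ht₁ t₂ ht₂ h12 ↦ by
      have := hvert x ((mem_closedBall_zero_iff.1 hx).trans hα₁₀) t₁ ht₁ t₂ ht₂ h12.le
      linarith)
    (fun x hx ↦ hneg_bot x (mem_closedBall_zero_iff.1 hx))
    (fun x hx ↦ hpos_top x (mem_closedBall_zero_iff.1 hx))
  have hgmem : ∀ x : E, ‖x‖ ≤ α₁ → g x ∈ Icc (σ - α₀) (σ + α₀) := fun x hx ↦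
    Ioo_subset_Icc_self (hg x (mem_closedBall_zero_iff.2 hx)).1
  have hgzero : ∀ x : E, ‖x‖ ≤ α₁ → G' (x, g x) = 0 := fun x hx ↦
    (hg x (mem_closedBall_zero_iff.2 hx)).2
  -- closeness to `σ` and the Lipschitz bound, both with constant `2M`
  have hclose : ∀ x : E, ‖x‖ ≤ α₁ → |g x - σ| ≤ 2 * M * ‖x‖ := by
    intro x hx
    have hh := hhoriz 0 x (g x) (by simpa using hα₀.le) (hx.trans hα₁₀) (hgmem x hx)
    rw [sub_zero, hgzero x hx, zero_sub, abs_neg] at hh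
    -- `G' (0, g x)` versus `G' (0, σ) = 0` along the vertical through `0`
    rcases le_total (g x) σ with hle | hle
    · have hv := hvert 0 (by simpa using hα₀.le) (g x) (hgmem x hx) σ hσmem hle
      rw [show G' ((0 : E), σ) = 0 from hG'0] at hv
      rw [abs_of_nonpos (by linarith : g x - σ ≤ 0)]
      linarith [(abs_le.1 hh).1, (abs_le.1 hh).2, abs_nonneg (G' (0, g x)),
        neg_abs_le (G' ((0 : E), g x))]
    · have hv := hvert 0 (by simpa using hα₀.le) σ hσmem (g x) (hgmem x hx) hle
      rw [show G' ((0 : E), σ) = 0 from hG'0] at hv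
      rw [abs_of_nonneg (by linarith : 0 ≤ g x - σ)]
      linarith [le_abs_self (G' ((0 : E), g x))]
  have hlip : ∀ x x' : E, ‖x‖ ≤ α₁ → ‖x'‖ ≤ α₁ → |g x - g x'| ≤ 2 * M * ‖x - x'‖ := by
    intro x x' hx hx'
    -- vertical at `x'` between the heights `g x` and `g x'`, horizontal at height `g x`
    have hh := hhoriz x x' (g x) (hx.trans hα₁₀) (hx'.trans hα₁₀) (hgmem x hx)
    rw [hgzero x hx, sub_zero] at hh
    rcases le_total (g x) (g x') with hle | hle
    · have hv := hvert x' (hx'.trans hα₁₀) (g x) (hgmem x hx) (g x') (hgmem x' hx') hle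
      rw [hgzero x' hx', zero_sub] at hv
      rw [abs_of_nonpos (by linarith : g x - g x' ≤ 0), norm_sub_rev]
      linarith [neg_abs_le (G' (x', g x))]
    · have hv := hvert x' (hx'.trans hα₁₀) (g x') (hgmem x' hx') (g x) (hgmem x hx) hle
      rw [hgzero x' hx', sub_zero] at hv
      rw [abs_of_nonneg (by linarith : 0 ≤ g x - g x'), norm_sub_rev]
      linarith [le_abs_self (G' (x', g x))]
  -- conclusion
  refine ⟨2 * M, by positivity, fun ε₁ hε₁ ↦ ?_⟩
  refine ⟨min α₁ (ε₁ / (2 * M + 1) / 2), by positivity, g, fun x hx ↦ ⟨?_, ?_⟩,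
    fun x x' hx hx' ↦ hlip x x' (hx.trans (min_le_left _ _)) (hx'.trans (min_le_left _ _))⟩
  · -- zero of `G` (not only of `G'`)
    have h := hgzero x (hx.trans (min_le_left _ _))
    simp only [hG'] at h
    rcases mul_eq_zero.1 h with h0 | h0
    · exact absurd h0 (inv_ne_zero hGt)
    · exact h0
  · have h := hclose x (hx.trans (min_le_left _ _))
    have hx2 : ‖x‖ ≤ ε₁ / (2 * M + 1) / 2 := hx.trans (min_le_right _ _)
    have : 2 * M * ‖x‖ < ε₁ := by
      calc 2 * M * ‖x‖ ≤ 2 * M * (ε₁ / (2 * M + 1) / 2) := by gcongr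
        _ = ε₁ * (M / (2 * M + 1)) := by ring
        _ < ε₁ * 1 := by
          gcongr
          exact (div_lt_one (by positivity)).2 (by linarith)
        _ = ε₁ := mul_one _
    linarith

end Summit.FinalStateConjecture.FinalStateConjecture.Theorems.LaminatedThreshold.Comb
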